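import Summits.Ventures.PercRepro.MSExcessCube
import Mathlib.Data.Finset.Max

/-!
# The strict Harris–Kleitman inequality, Lemma X, and the two coordinate identities of the excess

Dossier proofs/MINE1-theoremS.md, Addendum 58 (tools T0–T2), on the framework of
MSExcessCube.lean (cube `2^G`, `exc G D A = |D ∩ cofG G A| − |D ∩ A|`).

* `strict_rel`: if the down-set `D` and the up-set `A` both depend on `e ∈ G`, then
  `2 ^ |G| · |D ∩ A| < |D| · |A|` (split at `e`, Harris–Kleitman on the halves).
* LEMMA X in the form used here (`one_le_exc_of_crossSet_nonempty`): a minimal member `z` of `A`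
  with a crossed fibre (`crossSet D z ≠ ∅`) forces `exc ≥ 1`; its contrapositive
  `crossSet_eq_empty_of_exc_eq_zero` is the equality case of Harris.
* The two coordinate identities at `e ∈ G` (`exc_eq_identity₁`, `exc_eq_identity₂`): with
  `D₀ = D.nonMemberSubfamily e ⊇ D₁ = D.memberSubfamily e` and `A₀ ⊆ A₁` likewise,
  `exc G D A = exc G' D₀ A₁ + exc G' D₁ A₀ + |(D₀ ∖ D₁) ∩ (A₁ ∖ A₀)|`
  `         = exc G' D₀ A₀ + exc G' D₁ A₁ + |(D₀ ∖ D₁) ∩ cofG G' (A₁ ∖ A₀)|`,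
  all terms `≥ 0`; hence the face inequalities `exc G' Dᵢ Aⱼ ≤ exc G D A` (`exc_face_le`).
* The hypothesis (H) of Addendum 58 (`HypH D A c`: `c ∖ z ∈ D`, `c ∪ z ∉ D` for every minimal
  `z ∈ A`), the half `halfOf D c f` of `D` at `f` carrying the pattern of `c`, and the first
  consequences: (H) passes to `(halfOf D c f, A.nonMemberSubfamily f)` with witness `c.erase f`, and
  that face has excess exactly one (`exc_halfOf_eq_one`) — Addendum 58, (T3).
-/

namespace PercRepro.MSTight

open Finset

variable {α : Type*} [DecidableEq α]

section Strict

variable {G : Finset α} {A D : Finset (Finset α)} {e : α} {s z : Finset α}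

/-- **The strict Harris–Kleitman inequality** in the cube `2^G`: if the down-set `D` and the up-set
`A` both depend on the coordinate `e ∈ G`, then `2 ^ |G| · |D ∩ A| < |D| · |A|`. -/
theorem strict_rel (he : e ∈ G) (hD : IsLowerIn G D) (hA : IsUpperIn G A)
    (hDe : (D.memberSubfamily e).card < (D.nonMemberSubfamily e).card)
    (hAe : (A.nonMemberSubfamily e).card < (A.memberSubfamily e).card) :
    2 ^ G.card * (D ∩ A).card < D.card * A.card := by
  have h0 := kleitman_rel (isLowerIn_nonMember (e := e) hD) (isUpperIn_nonMember (e := e) hA)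
  have h1 := kleitman_rel (isLowerIn_member (e := e) hD) (isUpperIn_member he hA)
  have hDA := card_inter_split e D A
  have hD' := card_memberSubfamily_add_card_nonMemberSubfamily e D
  have hA' := card_memberSubfamily_add_card_nonMemberSubfamily e A
  rw [two_pow_card_erase he, hDA, ← hD', ← hA']
  obtain ⟨k, hk⟩ := Nat.exists_eq_add_of_lt hDe
  obtain ⟨l, hl⟩ := Nat.exists_eq_add_of_lt hAe
  rw [hk, hl]
  rw [hk] at h0
  rw [hl] at h1
  nlinarith [h0, h1]

/-- A minimal member `z ∋ e` of an up-set of the cube makes it depend on `e`. -/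
theorem card_nonMember_lt_card_member_of_min (he : e ∈ G) (hA : IsUpperIn G A)
    (hz : IsMinIn A z) (hez : e ∈ z) :
    (A.nonMemberSubfamily e).card < (A.memberSubfamily e).card := by
  apply card_lt_card
  refine ⟨nonMember_subset_member_of_upper he hA, ?_⟩
  intro hsub
  have h1 : z.erase e ∈ A.memberSubfamily e :=
    mem_memberSubfamily.2 ⟨by rw [insert_erase hez]; exact hz.1, notMem_erase e z⟩
  have h2 := (mem_nonMemberSubfamily.1 (hsub h1)).1
  have := hz.2 _ h2 (erase_subset e z)
  exact notMem_erase e z (by rw [this]; exact hez)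

/-- A crossed fibre over a set `z ⊆ G` makes the down-set depend on some coordinate of `z`. -/
theorem exists_depends_of_crossSet (hD : IsLowerIn G D) (hv : s ∈ crossSet D z) :
    ∃ e ∈ z, (D.memberSubfamily e).card < (D.nonMemberSubfamily e).card := by
  obtain ⟨hsD, hdisj, hsz⟩ := mem_crossSet.1 hv
  -- a maximal `t ⊆ z` with `s ∪ t ∈ D`
  set T := z.powerset.filter (fun t => s ∪ t ∈ D) with hT
  have hne : T.Nonempty := ⟨∅, by simp [hT, hsD]⟩
  obtain ⟨t, ht, hmax⟩ := exists_max_image T card hne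
  rw [hT, mem_filter, mem_powerset] at ht
  have htz : t ≠ z := fun h => hsz (h ▸ ht.2)
  obtain ⟨e, hez, het⟩ : ∃ e ∈ z, e ∉ t :=
    exists_of_ssubset (Finset.ssubset_iff_subset_ne.2 ⟨ht.1, htz⟩)
  refine ⟨e, hez, ?_⟩
  apply card_lt_card
  refine ⟨member_subset_nonMember_of_lower hD, ?_⟩
  intro hsub
  have hes : e ∉ s := fun h => (disjoint_left.1 hdisj) h hez
  have h1 : s ∪ t ∈ D.nonMemberSubfamily e := by
    refine mem_nonMemberSubfamily.2 ⟨ht.2, ?_⟩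
    simp [hes, het]
  have h2 := (mem_memberSubfamily.1 (hsub h1)).1
  have h3 : insert e t ∈ T := by
    rw [hT, mem_filter, mem_powerset]
    refine ⟨insert_subset hez ht.1, ?_⟩
    have : s ∪ insert e t = insert e (s ∪ t) := by
      ext x; simp only [mem_union, mem_insert]; tauto
    rwa [this]
  have := hmax _ h3
  rw [card_insert_of_notMem het] at this
  omega

/-- **Lemma X** (cube form): if some minimal member `z` of `A` has a crossed fibre, the excess
is at least one. -/
theorem one_le_exc_of_crossSet_nonempty (hD : IsLowerIn G D) (hA : IsUpperIn G A)
    (hz : IsMinIn A z) (hne : (crossSet D z).Nonempty) : 1 ≤ exc G D A := by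
  obtain ⟨v, hv⟩ := hne
  obtain ⟨e, hez, hDe⟩ := exists_depends_of_crossSet hD hv
  have heG : e ∈ G := hA.1 z hz.1 hez
  have hAe := card_nonMember_lt_card_member_of_min heG hA hz hez
  have h1 := strict_rel heG hD hA hDe hAe
  have h2 := harris_rel hD (isLowerIn_cofG hA)
  rw [card_cofG hA.1] at h2
  have h3 : 2 ^ G.card * (D ∩ A).card < 2 ^ G.card * (D ∩ cofG G A).card := h1.trans_le h2
  have h4 := Nat.lt_of_mul_lt_mul_left h3
  unfold exc
  omega

/-- The equality case: zero excess leaves no crossed fibre over any minimal member. -/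
theorem crossSet_eq_empty_of_exc_eq_zero (hD : IsLowerIn G D) (hA : IsUpperIn G A)
    (hz : IsMinIn A z) (h0 : exc G D A = 0) : crossSet D z = ∅ := by
  by_contra h
  have := one_le_exc_of_crossSet_nonempty hD hA hz (nonempty_iff_ne_empty.2 h)
  omega

end Strict

section Identities

variable {G : Finset α} {A D : Finset (Finset α)} {e : α} {s z : Finset α}

/-- `|D₀ ∩ X| = |D₁ ∩ X| + |(D₀ ∖ D₁) ∩ X|` for `D₁ ⊆ D₀`. -/
theorem card_inter_eq_add_of_subset {D₀ D₁ X : Finset (Finset α)} (h : D₁ ⊆ D₀) :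
    (D₀ ∩ X).card = (D₁ ∩ X).card + ((D₀ \ D₁) ∩ X).card := by
  rw [← card_union_of_disjoint]
  · congr 1
    ext v
    simp only [mem_inter, mem_union, mem_sdiff]
    constructor
    · rintro ⟨hv, hx⟩
      by_cases h1 : v ∈ D₁
      · exact Or.inl ⟨h1, hx⟩
      · exact Or.inr ⟨⟨hv, h1⟩, hx⟩
    · rintro (⟨hv, hx⟩ | ⟨⟨hv, -⟩, hx⟩)
      · exact ⟨h hv, hx⟩
      · exact ⟨hv, hx⟩
  · rw [disjoint_left]
    intro v hv hv'
    exact (mem_sdiff.1 (mem_inter.1 hv').1).2 (mem_inter.1 hv).1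

/-- **Identity (I1)** at `e ∈ G`:
`exc G D A = exc G' D₀ A₁ + exc G' D₁ A₀ + |(D₀ ∖ D₁) ∩ (A₁ ∖ A₀)|`. -/
theorem exc_eq_identity₁ (he : e ∈ G) (hD : IsLowerIn G D) (hA : IsUpperIn G A) :
    exc G D A = exc (G.erase e) (D.nonMemberSubfamily e) (A.memberSubfamily e) +
      exc (G.erase e) (D.memberSubfamily e) (A.nonMemberSubfamily e) +
      ((D.nonMemberSubfamily e \ D.memberSubfamily e) ∩
        (A.memberSubfamily e \ A.nonMemberSubfamily e)).card := by
  have hDsub := member_subset_nonMember_of_lower (e := e) hD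
  have hAsub := nonMember_subset_member_of_upper he hA
  have h1 := card_inter_split e D (cofG G A)
  have h2 := card_inter_split e D A
  rw [nonMember_cofG (A := A) he, member_cofG (A := A) he] at h1
  -- the four split terms
  have e1 := card_inter_eq_add_of_subset (X := A.memberSubfamily e \ A.nonMemberSubfamily e) hDsub
  have e2 := card_inter_eq_add_of_subset (D₀ := A.memberSubfamily e) (D₁ := A.nonMemberSubfamily e)
    (X := D.nonMemberSubfamily e) hAsub
  have e3 := card_inter_eq_add_of_subset (D₀ := A.memberSubfamily e) (D₁ := A.nonMemberSubfamily e)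
    (X := D.memberSubfamily e) hAsub
  unfold exc
  rw [h1, h2]
  rw [inter_comm (A.memberSubfamily e) (D.nonMemberSubfamily e),
    inter_comm (A.nonMemberSubfamily e) (D.nonMemberSubfamily e),
    inter_comm (A.memberSubfamily e \ A.nonMemberSubfamily e) (D.nonMemberSubfamily e)] at e2
  rw [inter_comm (A.memberSubfamily e) (D.memberSubfamily e),
    inter_comm (A.nonMemberSubfamily e) (D.memberSubfamily e),
    inter_comm (A.memberSubfamily e \ A.nonMemberSubfamily e) (D.memberSubfamily e)] at e3
  push_cast
  linarith

/-- **Identity (I2)** at `e ∈ G`: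
`exc G D A = exc G' D₀ A₀ + exc G' D₁ A₁ + |(D₀ ∖ D₁) ∩ cofG G' (A₁ ∖ A₀)|`. -/
theorem exc_eq_identity₂ (he : e ∈ G) (hD : IsLowerIn G D) (hA : IsUpperIn G A) :
    exc G D A = exc (G.erase e) (D.nonMemberSubfamily e) (A.nonMemberSubfamily e) +
      exc (G.erase e) (D.memberSubfamily e) (A.memberSubfamily e) +
      ((D.nonMemberSubfamily e \ D.memberSubfamily e) ∩
        cofG (G.erase e) (A.memberSubfamily e \ A.nonMemberSubfamily e)).card := by
  have hDsub := member_subset_nonMember_of_lower (e := e) hD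
  have hAsub := nonMember_subset_member_of_upper he hA
  have hA1 := (isUpperIn_member he hA).1
  have hcof := cofG_sdiff hA1 hAsub
  have hcsub : cofG (G.erase e) (A.nonMemberSubfamily e) ⊆ cofG (G.erase e) (A.memberSubfamily e) :=
    cofG_subset_cofG hAsub
  have h1 := card_inter_split e D (cofG G A)
  have h2 := card_inter_split e D A
  rw [nonMember_cofG (A := A) he, member_cofG (A := A) he] at h1
  have e1 := card_inter_eq_add_of_subset
    (X := cofG (G.erase e) (A.memberSubfamily e \ A.nonMemberSubfamily e)) hDsub
  have e2 := card_inter_eq_add_of_subset (X := D.nonMemberSubfamily e) hcsub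
  have e3 := card_inter_eq_add_of_subset (X := D.memberSubfamily e) hcsub
  rw [← hcof] at e2 e3
  rw [inter_comm _ (D.nonMemberSubfamily e), inter_comm _ (D.nonMemberSubfamily e),
    inter_comm _ (D.nonMemberSubfamily e)] at e2
  rw [inter_comm _ (D.memberSubfamily e), inter_comm _ (D.memberSubfamily e),
    inter_comm _ (D.memberSubfamily e)] at e3
  unfold exc
  rw [h1, h2]
  push_cast
  linarith

/-- All four face excesses are bounded by the excess (`0 ≤` each term of the identities). -/
theorem exc_face_le (he : e ∈ G) (hD : IsLowerIn G D) (hA : IsUpperIn G A) :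
    exc (G.erase e) (D.nonMemberSubfamily e) (A.memberSubfamily e) ≤ exc G D A ∧
    exc (G.erase e) (D.memberSubfamily e) (A.nonMemberSubfamily e) ≤ exc G D A ∧
    exc (G.erase e) (D.nonMemberSubfamily e) (A.nonMemberSubfamily e) ≤ exc G D A ∧
    exc (G.erase e) (D.memberSubfamily e) (A.memberSubfamily e) ≤ exc G D A := by
  have i1 := exc_eq_identity₁ he hD hA
  have i2 := exc_eq_identity₂ he hD hA
  have n01 := exc_nonneg (isLowerIn_nonMember (e := e) hD) (isUpperIn_member he hA)
  have n10 := exc_nonneg (isLowerIn_member (e := e) hD) (isUpperIn_nonMember (e := e) hA)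
  have n00 := exc_nonneg (isLowerIn_nonMember (e := e) hD) (isUpperIn_nonMember (e := e) hA)
  have n11 := exc_nonneg (isLowerIn_member (e := e) hD) (isUpperIn_member he hA)
  refine ⟨?_, ?_, ?_, ?_⟩ <;> [skip; skip; skip; skip] <;> omega

end Identities

section MinLost

variable {G : Finset α} {A D : Finset (Finset α)} {c s z : Finset α} {f g : α}

/-- The hypothesis (H) of Addendum 58: `c ∖ z ∈ D` and `c ∪ z ∉ D` for every minimal `z ∈ A`. -/
def HypH (D A : Finset (Finset α)) (c : Finset α) : Prop :=
  ∀ z, IsMinIn A z → c \ z ∈ D ∧ c ∪ z ∉ D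

/-- Every member of `A` contains a minimal member. -/
theorem exists_isMinIn_subset (ha : s ∈ A) : ∃ z, IsMinIn A z ∧ z ⊆ s := by
  obtain ⟨z, hz, hmin⟩ := exists_min_image (A.filter fun y => y ⊆ s) card ⟨s, by simp [ha]⟩
  rw [mem_filter] at hz
  refine ⟨z, ⟨hz.1, fun y hy hyz => ?_⟩, hz.2⟩
  have := hmin y (mem_filter.2 ⟨hy, hyz.trans hz.2⟩)
  exact eq_of_subset_of_card_le hyz this

/-- (H) passes to every member of `A`. -/
theorem HypH.mem (hH : HypH D A c) (hD : IsLowerIn G D) (ha : s ∈ A) : c \ s ∈ D ∧ c ∪ s ∉ D := by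
  obtain ⟨z, hz, hzs⟩ := exists_isMinIn_subset ha
  obtain ⟨h1, h2⟩ := hH z hz
  refine ⟨hD.2 (sdiff_subset_sdiff (subset_refl c) hzs) h1, fun h => h2 (hD.2 (union_subset_union (subset_refl c) hzs) h)⟩

/-- `c ∖ z` is a crossed fibre. -/
theorem HypH.sdiff_mem_crossSet (hH : HypH D A c) (hz : IsMinIn A z) : c \ z ∈ crossSet D z := by
  obtain ⟨h1, h2⟩ := hH z hz
  refine mem_crossSet.2 ⟨h1, disjoint_sdiff_self_left, ?_⟩
  rwa [sdiff_union_self_eq_union]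

/-- The half of `D` at `f` carrying the pattern of `c`. -/
def halfOf (D : Finset (Finset α)) (c : Finset α) (f : α) : Finset (Finset α) :=
  if f ∈ c then D.memberSubfamily f else D.nonMemberSubfamily f

/-- Membership in the `c`-half at `f`. -/
theorem mem_halfOf {v : Finset α} :
    v ∈ halfOf D c f ↔ f ∉ v ∧ (if f ∈ c then insert f v ∈ D else v ∈ D) := by
  unfold halfOf
  split_ifs with h
  · rw [mem_memberSubfamily]; tauto
  · rw [mem_nonMemberSubfamily]; tauto

/-- The `c`-half at `f` of a down-set of `2^G` is a down-set of `2^{G.erase f}`. -/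
theorem isLowerIn_halfOf (hD : IsLowerIn G D) : IsLowerIn (G.erase f) (halfOf D c f) := by
  unfold halfOf
  split_ifs
  · exact isLowerIn_member hD
  · exact isLowerIn_nonMember hD

/-- Membership of `v ∖ f` in the `c`-half, for `v` agreeing with `c` at `f`. -/
theorem erase_mem_halfOf_iff {v : Finset α} (hv : f ∈ v ↔ f ∈ c) :
    v.erase f ∈ halfOf D c f ↔ v ∈ D := by
  rw [mem_halfOf]
  have hne : f ∉ v.erase f := notMem_erase f v
  simp only [hne, not_false_eq_true, true_and]
  split_ifs with h
  · rw [insert_erase (hv.2 h)]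
  · rw [erase_eq_of_notMem (fun h' => h (hv.1 h'))]

/-- The `c`-half at a coordinate `f` avoided by some minimal member satisfies (H) with `c.erase f`. -/
theorem HypH.halfOf (hH : HypH D A c) :
    HypH (halfOf D c f) (A.nonMemberSubfamily f) (c.erase f) := by
  intro z hz
  obtain ⟨hzA, hfz⟩ := mem_nonMemberSubfamily.1 hz.1
  have hzmin : IsMinIn A z := by
    refine ⟨hzA, fun y hy hyz => hz.2 y (mem_nonMemberSubfamily.2 ⟨hy, fun h => hfz (hyz h)⟩) hyz⟩
  obtain ⟨h1, h2⟩ := hH z hzmin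
  constructor
  · rw [mem_halfOf]
    refine ⟨by simp, ?_⟩
    split_ifs with hfc
    · have : insert f (c.erase f \ z) = c \ z := by
        ext x; simp only [mem_insert, mem_sdiff, mem_erase]; constructor
        · rintro (rfl | ⟨⟨-, hxc⟩, hxz⟩)
          · exact ⟨hfc, hfz⟩
          · exact ⟨hxc, hxz⟩
        · rintro ⟨hxc, hxz⟩
          by_cases hxf : x = f
          · exact Or.inl hxf
          · exact Or.inr ⟨⟨hxf, hxc⟩, hxz⟩
      rwa [this]
    · rw [erase_eq_of_notMem hfc]; exact h1
  · rw [mem_halfOf]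
    simp only [mem_union, notMem_erase, false_or, not_and]
    intro hfz'
    split_ifs with hfc
    · intro h
      apply h2
      have : insert f (c.erase f ∪ z) = c ∪ z := by
        ext x; simp only [mem_insert, mem_union, mem_erase]; constructor
        · rintro (rfl | ⟨-, hxc⟩ | hxz)
          · exact Or.inl hfc
          · exact Or.inl hxc
          · exact Or.inr hxz
        · rintro (hxc | hxz)
          · by_cases hxf : x = f
            · exact Or.inl hxf
            · exact Or.inr (Or.inl ⟨hxf, hxc⟩)
          · exact Or.inr (Or.inr hxz)
      rwa [this] at h
    · rw [erase_eq_of_notMem hfc]; exact h2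

/-- A minimal member of `A` avoiding `f` is a minimal member of the `f`-free subfamily. -/
theorem isMinIn_nonMember (hz : IsMinIn A z) (hfz : f ∉ z) : IsMinIn (A.nonMemberSubfamily f) z := by
  refine ⟨mem_nonMemberSubfamily.2 ⟨hz.1, hfz⟩, fun y hy hyz => hz.2 y (mem_nonMemberSubfamily.1 hy).1 hyz⟩

/-- The `c`-half at `f ∉ z` has excess exactly one. -/
theorem exc_halfOf_eq_one (hD : IsLowerIn G D) (hA : IsUpperIn G A) (hH : HypH D A c)
    (h1 : exc G D A = 1) (hf : f ∈ G) (hz : IsMinIn A z) (hfz : f ∉ z) :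
    exc (G.erase f) (halfOf D c f) (A.nonMemberSubfamily f) = 1 := by
  have hle : exc (G.erase f) (halfOf D c f) (A.nonMemberSubfamily f) ≤ exc G D A := by
    unfold halfOf
    obtain ⟨-, h10, h00, -⟩ := exc_face_le hf hD hA
    split_ifs
    · exact h10
    · exact h00
  have hge := one_le_exc_of_crossSet_nonempty (isLowerIn_halfOf (f := f) (c := c) hD)
    (isUpperIn_nonMember (e := f) hA) (isMinIn_nonMember hz hfz)
    ⟨_, (hH.halfOf (f := f)).sdiff_mem_crossSet (isMinIn_nonMember hz hfz)⟩
  omega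

end MinLost

end PercRepro.MSTight
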